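import Literature.Analysis.OperatorTheory.ContractionSemigroupLaplace
import Literature.Analysis.OperatorTheory.PowerMoments
import Literature.Analysis.OperatorTheory.SesquilinearExtension
import HarnessLib

/-!
# Holomorphic matrix elements of a symmetric contraction semigroup (E1-locality toolkit I)

Helper file for stub `stub_locality` of crux `OSLegsAtWeakCouplingC` (stmt-QuantumFields-16207, line `Sketch`).
Abstract operator theory, no Schwinger functions: for a semigroup `S t` (`t > 0`) of self-adjoint contractions on a
complex Hilbert space, the matrix elements `t ↦ ⟪x, S t y⟫` are restrictions of functions holomorphic on the open
right half-plane, sesquilinear in `(x, y)` and bounded by `2 ‖x‖ ‖y‖` there (Osterwalder–Schrader I, §4.1 p. 92: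
"`T^τ = e^{-τH}` is a holomorphic semigroup for `Re τ > 0`"), obtained WITHOUT strong continuity from the tree's
Laplace representation `⟪ψ, S t ψ⟫ = ∫ x^t dμ_ψ(x)` (`SymmContractionSemigroup.inner_eq_integral_rpow`) and the
complex power moments `cpowMoment` (`Literature.Analysis.OperatorTheory.PowerMoments`), by polarization and the
identity theorem from the positive real axis.  Main statement: `exists_holomorphic_matrixElem`.
-/

noncomputable section

open MeasureTheory Set Filter Complex
open _root_.Topology
open scoped InnerProductSpace NNReal ComplexConjugate

-- CFC instance chain on `H →L[ℂ] H` (see `ContractionSemigroupLaplace`).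
set_option synthInstance.maxHeartbeats 200000

namespace Summit.QuantumFields.YangMills.Theorems.OSLegsAtWeakCouplingC

open Literature.Analysis.OperatorTheory

variable {H : Type*} [NormedAddCommGroup H] [InnerProductSpace ℂ H] [CompleteSpace H]
variable {S : ℝ → H →L[ℂ] H}

/-! ### The identity theorem from the positive real axis (open half-plane form) -/

/-- **Identity theorem from the positive real axis, open form.** Two functions holomorphic on `{Re z > 0}` that
agree at every real `s > 0` agree on `{Re z > 0}`. -/
theorem eqOn_halfPlane_of_eqOn_ofReal {f g : ℂ → ℂ}
    (hf : DifferentiableOn ℂ f {z : ℂ | 0 < z.re}) (hg : DifferentiableOn ℂ g {z : ℂ | 0 < z.re})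
    (h : ∀ s : ℝ, 0 < s → f s = g s) : EqOn f g {z : ℂ | 0 < z.re} := by
  have hU : IsOpen {z : ℂ | 0 < z.re} := isOpen_lt continuous_const Complex.continuous_re
  have hfa : AnalyticOnNhd ℂ f {z : ℂ | 0 < z.re} := hf.analyticOnNhd hU
  have hga : AnalyticOnNhd ℂ g {z : ℂ | 0 < z.re} := hg.analyticOnNhd hU
  have hpc : IsPreconnected {z : ℂ | 0 < z.re} := (convex_halfSpace_re_gt (r := 0)).isPreconnected
  have h1 : (1 : ℂ) ∈ {z : ℂ | 0 < z.re} := by simp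
  refine hfa.eqOn_of_preconnected_of_frequently_eq hga hpc h1 ?_
  have hreal : ∀ᶠ t : ℝ in 𝓝 1, f t = g t := by
    filter_upwards [Ioi_mem_nhds (zero_lt_one' ℝ)] with t ht using h t ht
  have htend : Tendsto (fun t : ℝ => (t : ℂ)) (𝓝[≠] 1) (𝓝[≠] 1) := by
    refine (Complex.continuous_ofReal.continuousWithinAt).tendsto_nhdsWithin ?_
    intro t ht
    simpa using ht
  simpa using htend.frequently (eventually_nhdsWithin_of_eventually_nhds hreal).frequently

/-! ### The spectral measure of `S 1` at a vector, pushed to `ℝ` -/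

section Spectral

variable (hadd : ∀ s t : ℝ, 0 < s → 0 < t → S (s + t) = S s * S t)
  (hsa : ∀ t : ℝ, 0 < t → IsSelfAdjoint (S t)) (hcontr : ∀ t : ℝ, 0 < t → ‖S t‖ ≤ 1)

variable (S) in
/-- The spectrum of `S 1` is a measurable subset of `ℝ` (it is compact). -/
theorem measurableSet_spectrum_one : MeasurableSet (spectrum ℝ (S 1)) :=
  (ContinuousFunctionalCalculus.isCompact_spectrum (R := ℝ) (S 1)).isClosed.measurableSet

variable (S) in
/-- The inclusion of the spectrum of `S 1` into `ℝ` is a measurable embedding. -/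
theorem measurableEmbedding_spectrum_coe :
    MeasurableEmbedding ((↑) : spectrum ℝ (S 1) → ℝ) :=
  MeasurableEmbedding.subtype_coe (measurableSet_spectrum_one S)

/-- **`ν_ψ`, the scalar spectral measure of `S 1` at `ψ` as a measure on `ℝ`**: a finite measure carried by
`[0, 1]` of total mass `‖ψ‖²`. -/
def specMeasureReal (ψ : H) : Measure ℝ :=
  (scalarSpectralMeasure (S 1) (hsa 1 one_pos) ψ).map ((↑) : spectrum ℝ (S 1) → ℝ)

/-- `ν_ψ` is finite. -/
instance instIsFiniteMeasureSpecMeasureReal (ψ : H) : IsFiniteMeasure (specMeasureReal hsa ψ) := by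
  unfold specMeasureReal; infer_instance

/-- Integrals against `ν_ψ` are integrals against the spectral measure. -/
theorem integral_specMeasureReal (ψ : H) {E : Type*} [NormedAddCommGroup E] [NormedSpace ℝ E] (g : ℝ → E) :
    ∫ t, g t ∂(specMeasureReal hsa ψ) = ∫ x, g (x : ℝ) ∂(scalarSpectralMeasure (S 1) (hsa 1 one_pos) ψ) :=
  (measurableEmbedding_spectrum_coe S).integral_map g

include hadd hcontr in
/-- `ν_ψ` is carried by `[0, 1]`. -/
theorem specMeasureReal_ae_mem_Icc (ψ : H) : ∀ᵐ t ∂(specMeasureReal hsa ψ), t ∈ Icc (0 : ℝ) 1 :=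
  ((measurableEmbedding_spectrum_coe S).ae_map_iff).2
    (Eventually.of_forall fun x => SymmContractionSemigroup.coe_mem_Icc hadd hsa hcontr x)

/-- Total mass `ν_ψ(ℝ) = ‖ψ‖²`. -/
theorem specMeasureReal_real_univ (ψ : H) : (specMeasureReal hsa ψ).real univ = ‖ψ‖ ^ 2 := by
  rw [← scalarSpectralMeasure_univ_real (S 1) (hsa 1 one_pos) ψ, Measure.real, Measure.real, specMeasureReal,
    (measurableEmbedding_spectrum_coe S).map_apply, preimage_univ]

include hadd hcontr in
/-- The real power integrals against `ν_ψ` are the diagonal matrix elements: `∫ t^s dν_ψ = ⟪ψ, S s ψ⟫`, `s > 0`. -/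
theorem integral_rpow_specMeasureReal (ψ : H) {s : ℝ} (hs : 0 < s) :
    ((∫ t, t ^ s ∂(specMeasureReal hsa ψ) : ℝ) : ℂ) = ⟪ψ, S s ψ⟫_ℂ := by
  rw [integral_specMeasureReal, SymmContractionSemigroup.inner_eq_integral_rpow hadd hsa hcontr ψ hs]

end Spectral

/-! ### The diagonal elements `⟪ψ, S τ ψ⟫` and their polarization -/

section Diagonal

variable (hadd : ∀ s t : ℝ, 0 < s → 0 < t → S (s + t) = S s * S t)
  (hsa : ∀ t : ℝ, 0 < t → IsSelfAdjoint (S t)) (hcontr : ∀ t : ℝ, 0 < t → ‖S t‖ ≤ 1)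

/-- **The diagonal element `⟪ψ, S τ ψ⟫` for complex `τ`**: the power moment `∫ t^τ dν_ψ(t)`. -/
def diagElem (ψ : H) (τ : ℂ) : ℂ := cpowMoment (specMeasureReal hsa ψ) τ

include hadd hcontr in
/-- Agreement with the semigroup on the positive real axis. -/
theorem diagElem_ofReal (ψ : H) {s : ℝ} (hs : 0 < s) : diagElem hsa ψ s = ⟪ψ, S s ψ⟫_ℂ := by
  rw [diagElem, cpowMoment_ofReal ((specMeasureReal_ae_mem_Icc hadd hsa hcontr ψ).mono fun _ ht => ht.1),
    integral_rpow_specMeasureReal hadd hsa hcontr ψ hs]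

include hadd hcontr in
/-- Holomorphy of the diagonal element on `{Re τ > 0}`. -/
theorem differentiableOn_diagElem (ψ : H) : DifferentiableOn ℂ (diagElem hsa ψ) {τ | 0 < τ.re} :=
  differentiableOn_cpowMoment (specMeasureReal_ae_mem_Icc hadd hsa hcontr ψ)

include hadd hcontr in
/-- Uniform bound `|⟪ψ, S τ ψ⟫| ≤ ‖ψ‖²` for `Re τ ≥ 0`. -/
theorem norm_diagElem_le (ψ : H) {τ : ℂ} (hτ : 0 ≤ τ.re) : ‖diagElem hsa ψ τ‖ ≤ ‖ψ‖ ^ 2 := by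
  rw [← specMeasureReal_real_univ hsa ψ]
  exact norm_cpowMoment_le (specMeasureReal_ae_mem_Icc hadd hsa hcontr ψ) hτ

/-- **The matrix element `⟪x, S τ y⟫`**: the polarization of the diagonal elements. -/
def matElem (x y : H) (τ : ℂ) : ℂ := polarization (fun χ => diagElem hsa χ τ) x y

include hadd hcontr in
/-- On the positive real axis the matrix element is the semigroup matrix element. -/
theorem matElem_ofReal (x y : H) {s : ℝ} (hs : 0 < s) : matElem hsa x y s = ⟪x, S s y⟫_ℂ := by
  rw [matElem, inner_apply_eq_polarization]
  congr 1
  funext χ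
  exact diagElem_ofReal hadd hsa hcontr χ hs

include hadd hcontr in
/-- Holomorphy of the matrix element on `{Re τ > 0}`. -/
theorem differentiableOn_matElem (x y : H) : DifferentiableOn ℂ (matElem hsa x y) {τ | 0 < τ.re} := by
  have hd := fun χ => differentiableOn_diagElem hadd hsa hcontr χ
  unfold matElem polarization
  refine DifferentiableOn.div_const ?_ _
  refine ((((hd _).sub (hd _)).sub ((differentiableOn_const _).mul (hd _))).add
    ((differentiableOn_const _).mul (hd _)))

include hadd hcontr in
/-- The quadratic bound `|matElem x y τ| ≤ ‖x‖² + ‖y‖²` for `Re τ ≥ 0`. -/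
theorem norm_matElem_le_sq_add_sq (x y : H) {τ : ℂ} (hτ : 0 ≤ τ.re) :
    ‖matElem hsa x y τ‖ ≤ 1 * (‖x‖ ^ 2 + ‖y‖ ^ 2) :=
  norm_polarization_le (fun χ => by rw [one_mul]; exact norm_diagElem_le hadd hsa hcontr χ hτ) x y

include hadd hcontr in
/-- **Sesquilinearity of the matrix element for `Re τ > 0`**, transferred from the real axis by the identity theorem. -/
theorem isSesqForm_matElem {τ : ℂ} (hτ : 0 < τ.re) : IsSesqForm fun x y => matElem hsa x y τ := by
  have hD := fun x y => differentiableOn_matElem hadd hsa hcontr x y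
  have hreal : ∀ (x y : H) (s : ℝ), 0 < s → matElem hsa x y s = ⟪x, S s y⟫_ℂ :=
    fun x y s hs => matElem_ofReal hadd hsa hcontr x y hs
  refine ⟨fun x x' y => ?_, fun c x y => ?_, fun x y y' => ?_, fun c x y => ?_⟩
  · refine eqOn_halfPlane_of_eqOn_ofReal (hD (x + x') y) ((hD x y).add (hD x' y)) (fun s hs => ?_) hτ
    simp only [Pi.add_apply, hreal _ _ s hs, inner_add_left]
  · refine eqOn_halfPlane_of_eqOn_ofReal (hD (c • x) y) ((differentiableOn_const _).mul (hD x y))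
      (fun s hs => ?_) hτ
    simp only [Pi.mul_apply, hreal _ _ s hs, inner_smul_left]
  · refine eqOn_halfPlane_of_eqOn_ofReal (hD x (y + y')) ((hD x y).add (hD x y')) (fun s hs => ?_) hτ
    simp only [Pi.add_apply, hreal _ _ s hs, map_add, inner_add_right]
  · refine eqOn_halfPlane_of_eqOn_ofReal (hD x (c • y)) ((differentiableOn_const _).mul (hD x y))
      (fun s hs => ?_) hτ
    simp only [Pi.mul_apply, hreal _ _ s hs, map_smul, inner_smul_right]

include hadd hcontr in
/-- **The product bound** `|matElem x y τ| ≤ 2 ‖x‖ ‖y‖` for `Re τ > 0` (sesquilinearity + scaling). -/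
theorem norm_matElem_le {τ : ℂ} (hτ : 0 < τ.re) (x y : H) : ‖matElem hsa x y τ‖ ≤ 2 * ‖x‖ * ‖y‖ := by
  have h := (isSesqForm_matElem hadd hsa hcontr hτ).norm_le_of_norm_le_sq_add_sq
    (fun x y => norm_matElem_le_sq_add_sq hadd hsa hcontr x y hτ.le) x y
  simpa using h

end Diagonal

/-! ### Packaged statement -/

omit [CompleteSpace H] in
/-- Differences of a bounded sesquilinear function. -/
theorem norm_sub_sesq {M : H → H → ℂ} (hM : IsSesqForm M) {C : ℝ} (hC : ∀ x y, ‖M x y‖ ≤ C * ‖x‖ * ‖y‖)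
    (x x' y y' : H) : ‖M x y - M x' y'‖ ≤ C * ‖x - x'‖ * ‖y‖ + C * ‖x'‖ * ‖y - y'‖ := by
  have h1 : M x y - M x' y' = M (x - x') y + M x' (y - y') := by
    have ha := hM.add_left (x - x') x' y
    have hb := hM.add_right x' (y - y') y'
    rw [sub_add_cancel] at ha hb
    rw [ha, hb]; ring
  rw [h1]
  exact (norm_add_le _ _).trans (add_le_add (hC _ _) (hC _ _))

/-- **Holomorphic matrix elements of a symmetric contraction semigroup.**  For a semigroup `S t` (`t > 0`) of
self-adjoint contractions on a complex Hilbert space there is `M : H → H → ℂ → ℂ` with: `M x y t = ⟪x, S t y⟫` for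
real `t > 0`; `τ ↦ M x y τ` holomorphic on `{Re τ > 0}`; `M · · τ` sesquilinear with `|M x y τ| ≤ 2 ‖x‖ ‖y‖`
(`Re τ > 0`); hence `|M x y τ − M x' y' τ| ≤ 2 ‖x − x'‖ ‖y‖ + 2 ‖x'‖ ‖y − y'‖` (joint continuity in the vectors,
uniformly in `τ`).  No continuity of `S` is assumed. -/
theorem exists_holomorphic_matrixElem (S : ℝ → H →L[ℂ] H) (hadd : ∀ s t : ℝ, 0 < s → 0 < t → S (s + t) = S s * S t) (hsa : ∀ t : ℝ, 0 < t → IsSelfAdjoint (S t)) (hcontr : ∀ t : ℝ, 0 < t → ‖S t‖ ≤ 1) : ∃ M : H → H → ℂ → ℂ, (∀ (x y : H) (t : ℝ), 0 < t → M x y t = ⟪x, S t y⟫_ℂ) ∧ (∀ x y : H, DifferentiableOn ℂ (M x y) {τ : ℂ | 0 < τ.re}) ∧ (∀ τ : ℂ, 0 < τ.re → IsSesqForm fun x y => M x y τ) ∧ (∀ (x y : H) (τ : ℂ), 0 < τ.re → ‖M x y τ‖ ≤ 2 * ‖x‖ * ‖y‖) ∧ (∀ (x x' y y' : H) (τ :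 ℂ), 0 < τ.re → ‖M x y τ - M x' y' τ‖ ≤ 2 * ‖x - x'‖ * ‖y‖ + 2 * ‖x'‖ * ‖y - y'‖) := by
  refine ⟨matElem hsa, fun x y t ht => matElem_ofReal hadd hsa hcontr x y ht,
    fun x y => differentiableOn_matElem hadd hsa hcontr x y, fun τ hτ => isSesqForm_matElem hadd hsa hcontr hτ,
    fun x y τ hτ => norm_matElem_le hadd hsa hcontr hτ x y, fun x x' y y' τ hτ => ?_⟩
  exact norm_sub_sesq (isSesqForm_matElem hadd hsa hcontr hτ) (fun x y => norm_matElem_le hadd hsa hcontr hτ x y)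
    x x' y y'

end Summit.QuantumFields.YangMills.Theorems.OSLegsAtWeakCouplingC

end
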